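import Literature.NumberTheory.ModularForms.Lemma49Tools24
import HarnessLib

/-!
# CKMRV Lemma 4.9 (4.15), (4.17) for `𝒦₊^{(24)}` (`γ ∈ {I, T, TS}`)

Cohn–Kumar–Miller–Radchenko–Viazovska, arXiv:1902.05438, Lemma 4.9 with `n_{+,τ} = 0`, `n_{+,z} = 2`,
`n̂_τ^{(24)} = 4`, `d = 24` (so `|^z_{2−d/2}S = |^z_{−10}S`): for `Im τ, Im z ≥ δ`,
(4.15) `|(𝒦₊^{(24)}|^τ_{12}γ|^z_{−10}S)(τ,z)| ≤ C|e^{2πiz}τ²z²/(Δ(τ)Δ(z)(j(τ)−j(z)))|`,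
(4.17) `|(𝒦₊^{(24)}|^z_{−10}S)(τ,z)| ≤ C|e^{πi(4τ+z)}τ²z²/(Δ(τ)Δ(z)(j(τ)−j(z)))|`.

With rows `(R₋₂, R₀, R₂)` (`R = φ|γ`), `𝒦₊^{(24)}(τ,Sz)z^{10}Δ(τ)Δ(z)(j(τ)−j(z)) = c·L_R(τ,z)` where
`L_R = Σᵢ fᵢ(τ)Gᵢ(z)` with `f = (R₋₂E₁₄E₄³, R₋₂E₁₄Δ, R₀E₄⁶, R₀E₄³Δ, R₀Δ², R₂E₁₀E₄³, R₂E₁₀Δ)` and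
`G₁ = G₆ = 6(E₄−E₂²)`, `G₂ = 𝔠E₂² + 6j(E₂²−E₄)`, `G₃ = −12(E₄−E₂²)`, `G₄ = 5𝔠E₄ − 7𝔠E₂² + 12j(E₄−E₂²)`,
`G₅ = 𝔠(−5jE₄ − 2(E₁₄/Δ)E₂ + 7jE₂²)`, `G₇ = 𝔠E₄ − 6j(E₄−E₂²)` (functions of `z`; `𝔠 = 1728`): every
`Gᵢ = O(e^{−2π Im z})` (the `q_z^{−1}` and `q_z⁰` coefficients cancel), which gives (4.15) for rows
that are `O(|τ|²)`; for the rows `φ` moreover `Σᵢ Pᵢ Gᵢ = 0` for the truncations `Pᵢ` of `fᵢ` modulo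
`q_τ²`, which gives (4.17). All PROVED (`kernelPlus24_S_bound_415`, `kernelPlus24_S_bound_417`).

## References

* H. Cohn, A. Kumar, S. D. Miller, D. Radchenko, M. Viazovska, Ann. of Math. 196 (2022),
  arXiv:1902.05438, §4.4 (4.13), Lemma 4.9 (4.15), (4.17). [CohnEtAl2019]
-/

noncomputable section

open Complex hiding I
open Filter Topology Asymptotics ModularForm SlashInvariantForm EisensteinSeries
open UpperHalfPlane hiding I
open Complex (I)
open scoped Real MatrixGroups ModularForm Manifold

namespace Literature.NumberTheory.ModularForms

open Literature.NumberTheory.EllipticCurves.ModularForms (kleinJ kleinJ_smul continuous_kleinJ E₄_cube_eq_kleinJ_mul)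

/-! ## The row-parametrised kernel -/

/-- `𝒦₊^{(24)}` with rows `R₋₂, R₀, R₂` in place of `φ₋₂, φ₀, φ₂`. [cite: CohnEtAl2019, §4.4 (4.13)] -/
def plus24Kernel (Rm R0 R2 : ℍ → ℂ) (τ z : ℍ) : ℂ :=
  (π : ℂ) ^ 2 / (36 * 1728 * I) / (ModularForm.discriminant z * (kleinJ τ - kleinJ z)) *
    (Rm τ * E14fun τ *
        (6 * (kleinJ τ - kleinJ z) * E₄ z * phiTildeNeg2 z + (1728 - 6 * (kleinJ τ - kleinJ z)) * phiTilde2 z) +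
      R0 τ * ModularForm.discriminant τ *
        ((-12 * kleinJ τ + 5 * 1728) * (kleinJ τ - kleinJ z) * E₄ z * phiTildeNeg2 z -
          2 * 1728 * f2fun z * phiTilde0 z + (12 * kleinJ τ - 7 * 1728) * (kleinJ τ - kleinJ z) * phiTilde2 z) +
      R2 τ * E10fun τ *
        ((1728 + 6 * (kleinJ τ - kleinJ z)) * E₄ z * phiTildeNeg2 z - 6 * (kleinJ τ - kleinJ z) * phiTilde2 z))

/-- `kernelPlus24_eq_plus24Kernel` (auxiliary). [cite: CohnEtAl2019, Lemma 4.9 (proof)] -/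
theorem kernelPlus24_eq_plus24Kernel : kernelPlus24 = plus24Kernel phiNeg2 phi0 phi2 := rfl

/-- Slashing in weight `12` acts on the rows (weights `−2, 0, 2`). [cite: CohnEtAl2019, §4.4] -/
theorem plus24Kernel_slash (Rm R0 R2 : ℍ → ℂ) (z : ℍ) (γ : SL(2, ℤ)) :
    (fun τ => plus24Kernel Rm R0 R2 τ z) ∣[(12 : ℤ)] γ =
      fun τ => plus24Kernel (Rm ∣[(-2 : ℤ)] γ) (R0 ∣[(0 : ℤ)] γ) (R2 ∣[(2 : ℤ)] γ) τ z := by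
  set c : ℂ := (π : ℂ) ^ 2 / (36 * 1728 * I) with hc
  set a₁ : ℍ → ℂ := E14fun * fun τ => c / (ModularForm.discriminant z * (kleinJ τ - kleinJ z)) *
    (6 * (kleinJ τ - kleinJ z) * E₄ z * phiTildeNeg2 z + (1728 - 6 * (kleinJ τ - kleinJ z)) * phiTilde2 z) with ha₁
  set a₂ : ℍ → ℂ := ModularForm.discriminant * fun τ => c / (ModularForm.discriminant z * (kleinJ τ - kleinJ z)) *
    ((-12 * kleinJ τ + 5 * 1728) * (kleinJ τ - kleinJ z) * E₄ z * phiTildeNeg2 z -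
      2 * 1728 * f2fun z * phiTilde0 z + (12 * kleinJ τ - 7 * 1728) * (kleinJ τ - kleinJ z) * phiTilde2 z) with ha₂
  set a₃ : ℍ → ℂ := E10fun * fun τ => c / (ModularForm.discriminant z * (kleinJ τ - kleinJ z)) *
    ((1728 + 6 * (kleinJ τ - kleinJ z)) * E₄ z * phiTildeNeg2 z - 6 * (kleinJ τ - kleinJ z) * phiTilde2 z) with ha₃
  have h₁ : IsLevelOneInvariant (-2 + 12 + 2 + 2) a₁ :=
    (isLevelOneInvariant_E14.mul (isLevelOneInvariant_comp_kleinJ fun j =>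
      c / (ModularForm.discriminant z * (j - kleinJ z)) *
        (6 * (j - kleinJ z) * E₄ z * phiTildeNeg2 z + (1728 - 6 * (j - kleinJ z)) * phiTilde2 z))).cast
      (by norm_num)
  have h₂ : IsLevelOneInvariant 12 a₂ :=
    (isLevelOneInvariant_discriminant.mul (isLevelOneInvariant_comp_kleinJ fun j =>
      c / (ModularForm.discriminant z * (j - kleinJ z)) *
        ((-12 * j + 5 * 1728) * (j - kleinJ z) * E₄ z * phiTildeNeg2 z -
          2 * 1728 * f2fun z * phiTilde0 z + (12 * j - 7 * 1728) * (j - kleinJ z) * phiTilde2 z))).cast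
      (by norm_num)
  have h₃ : IsLevelOneInvariant (12 - 2) a₃ :=
    (isLevelOneInvariant_E10.mul (isLevelOneInvariant_comp_kleinJ fun j =>
      c / (ModularForm.discriminant z * (j - kleinJ z)) *
        ((1728 + 6 * (j - kleinJ z)) * E₄ z * phiTildeNeg2 z - 6 * (j - kleinJ z) * phiTilde2 z))).cast
      (by norm_num)
  have key : ∀ (Sm S0 S2 : ℍ → ℂ), (fun τ => plus24Kernel Sm S0 S2 τ z) = Sm * a₁ + S0 * a₂ + S2 * a₃ := by
    intro Sm S0 S2; funext τ
    simp only [plus24Kernel, ha₁, ha₂, ha₃, hc, Pi.add_apply, Pi.mul_apply]; ring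
  rw [key, key, SlashAction.add_slash, SlashAction.add_slash, show (12 : ℤ) = -2 + (-2 + 12 + 2 + 2) by norm_num,
    mul_slash_SL2, h₁ γ, show (-2 : ℤ) + (-2 + 12 + 2 + 2) = 0 + 12 by norm_num, mul_slash_SL2, h₂ γ,
    show (0 : ℤ) + 12 = 2 + (12 - 2) by norm_num, mul_slash_SL2, h₃ γ]

/-! ## The `z`-side functions and the multiplied-out `S`-twist -/

/-- `G₁ = 6(E₄ − E₂²)`. [cite: CohnEtAl2019, Lemma 4.9 (proof)] -/
def G24a (z : ℍ) : ℂ := 6 * (E₄ z - E2 z ^ 2)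
/-- `G₂ = 𝔠E₂² + 6j(E₂² − E₄)`. [cite: CohnEtAl2019, Lemma 4.9 (proof)] -/
def G24b (z : ℍ) : ℂ := 1728 * E2 z ^ 2 + 6 * kleinJ z * (E2 z ^ 2 - E₄ z)
/-- `G₄ = 5𝔠E₄ − 7𝔠E₂² + 12j(E₄ − E₂²)`. [cite: CohnEtAl2019, Lemma 4.9 (proof)] -/
def G24d (z : ℍ) : ℂ := 5 * 1728 * E₄ z - 7 * 1728 * E2 z ^ 2 + 12 * kleinJ z * (E₄ z - E2 z ^ 2)
/-- `G₅ = 𝔠(−5jE₄ − 2(E₁₄/Δ)E₂ + 7jE₂²)`. [cite: CohnEtAl2019, Lemma 4.9 (proof)] -/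
def G24e (z : ℍ) : ℂ := 1728 * (-5 * kleinJ z * E₄ z - 2 * f2fun z * E2 z + 7 * kleinJ z * E2 z ^ 2)
/-- `G₇ = 𝔠E₄ − 6j(E₄ − E₂²)`. [cite: CohnEtAl2019, Lemma 4.9 (proof)] -/
def G24g (z : ℍ) : ℂ := 1728 * E₄ z - 6 * kleinJ z * (E₄ z - E2 z ^ 2)

/-- The `S`-twisted multiplied-out numerator `L_R = Σ fᵢ(τ)Gᵢ(z)` (without the constant `c`).
[cite: CohnEtAl2019, Lemma 4.9 (proof)] -/
def plus24SBracket (Rm R0 R2 : ℍ → ℂ) (τ z : ℍ) : ℂ :=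
  Rm τ * E14fun τ * E₄ τ ^ 3 * G24a z + Rm τ * E14fun τ * ModularForm.discriminant τ * G24b z
  + R0 τ * E₄ τ ^ 6 * (-2 * G24a z) + R0 τ * E₄ τ ^ 3 * ModularForm.discriminant τ * G24d z
  + R0 τ * ModularForm.discriminant τ ^ 2 * G24e z
  + R2 τ * E10fun τ * E₄ τ ^ 3 * G24a z + R2 τ * E10fun τ * ModularForm.discriminant τ * G24g z

/-- **The multiplied-out `S`-twist**: off the polar set,
`plus24Kernel R τ (Sz)·z^{10}·Δ(τ)Δ(z)(j(τ)−j(z)) = c·L_R(τ,z)`, `c = π²/(36·1728·i)`.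
[cite: CohnEtAl2019, Lemma 4.9 (proof)] -/
theorem plus24Kernel_S_mul_eq (Rm R0 R2 : ℍ → ℂ) (τ z : ℍ) (hJ : kleinJ τ - kleinJ z ≠ 0) :
    plus24Kernel Rm R0 R2 τ (ModularGroup.S • z) * (z : ℂ) ^ 10 *
      (ModularForm.discriminant τ * ModularForm.discriminant z * (kleinJ τ - kleinJ z)) =
        (π : ℂ) ^ 2 / (36 * 1728 * I) * plus24SBracket Rm R0 R2 τ z := by
  have hz : (z : ℂ) ≠ 0 := z.ne_zero
  have hΔz := ModularForm.discriminant_ne_zero z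
  have hΔτ := ModularForm.discriminant_ne_zero τ
  have hI : (36 * 1728 * I : ℂ) ≠ 0 := by simp [I_ne_zero]
  have hjz : kleinJ z * ModularForm.discriminant z = E₄ z ^ 3 := (E₄_cube_eq_kleinJ_mul z).symm
  have hjτ : kleinJ τ * ModularForm.discriminant τ = E₄ τ ^ 3 := (E₄_cube_eq_kleinJ_mul τ).symm
  simp only [plus24Kernel, plus24SBracket, G24a, G24b, G24d, G24e, G24g, kleinJ_smul, discriminant_S_smul',
    phiTildeNeg2_S_smul, phiTilde0_S_smul, phiTilde2_S_smul, E14fun, E10fun, f2fun, Pi.mul_apply, Pi.inv_apply,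
    E₄_S_smul, E₆_S_smul]
  field_simp
  have e1 : kleinJ τ = E₄ τ ^ 3 / ModularForm.discriminant τ := by rw [eq_div_iff hΔτ]; exact hjτ
  rw [e1]
  field_simp
  ring

/-- `norm_plus24Kernel_S_mul_le` (auxiliary). [cite: CohnEtAl2019, Lemma 4.9 (proof)] -/
theorem norm_plus24Kernel_S_mul_le (Rm R0 R2 : ℍ → ℂ) (τ z : ℍ) :
    ‖plus24Kernel Rm R0 R2 τ (ModularGroup.S • z) * (z : ℂ) ^ 10 *
      (ModularForm.discriminant τ * ModularForm.discriminant z * (kleinJ τ - kleinJ z))‖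
        ≤ ‖(π : ℂ) ^ 2 / (36 * 1728 * I)‖ * ‖plus24SBracket Rm R0 R2 τ z‖ := by
  by_cases hJ : kleinJ τ - kleinJ z = 0
  · rw [hJ]; simp; positivity
  · rw [plus24Kernel_S_mul_eq Rm R0 R2 τ z hJ, norm_mul]

/-! ## The `z`-side functions are `O(e^{−2π Im z})` -/

/-- At `i∞`: `G₁, G₂, G₄, G₅, G₇ = O(q)` (the `q^{−1}` and `q⁰` coefficients cancel).
[cite: CohnEtAl2019, Lemma 4.9 (proof)] -/
theorem G24_isBigO_atImInfty :
    (G24a =O[atImInfty] expDecay) ∧ (G24b =O[atImInfty] expDecay) ∧ (G24d =O[atImInfty] expDecay) ∧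
    (G24e =O[atImInfty] expDecay) ∧ (G24g =O[atImInfty] expDecay) := by
  have hq : (fun τ => qfun τ) =O[atImInfty] expDecay := qfun_isBigO
  have hq1 : (fun τ => qfun τ) =O[atImInfty] fun _ : ℍ => (1 : ℝ) := qfun_isBigO_one
  have h2 := E2_second_order
  have h4 := E₄_second_order
  have hj := kleinJ_mul_q_second_order
  have hf := qfun_mul_f2fun_second_order
  have h21 : (fun τ : ℍ => E2 τ - 1) =O[atImInfty] expDecay := E2_sub_one_isBigO
  have h41 : (fun τ : ℍ => E₄ τ - 1) =O[atImInfty] expDecay := E₄_sub_one_isBigO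
  have one1 : (fun _ : ℍ => (1 : ℂ)) =O[atImInfty] fun _ : ℍ => (1 : ℝ) := isBigO_const_const _ one_ne_zero _
  have hE2b : E2 =O[atImInfty] fun _ : ℍ => (1 : ℝ) := by
    have := (h21.trans expDecay_isBigO_one').add one1; simpa using this
  have hE4b : (⇑E₄ : ℍ → ℂ) =O[atImInfty] fun _ : ℍ => (1 : ℝ) := by
    have := (h41.trans expDecay_isBigO_one').add one1; simpa using this
  -- `E₂² − E₄ + 288q = O(q²)`
  have hu2 : (fun τ : ℍ => E2 τ ^ 2 - E₄ τ + 288 * qfun τ) =O[atImInfty] fun τ => expDecay τ ^ 2 := by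
    have t1 : (fun τ : ℍ => (E2 τ - 1 + 24 * qfun τ) * (E2 τ + 1)) =O[atImInfty] fun τ => expDecay τ ^ 2 := by
      simpa using h2.mul (hE2b.add one1)
    have t3 : (fun τ : ℍ => 24 * qfun τ * (E2 τ - 1)) =O[atImInfty] fun τ => expDecay τ ^ 2 := by
      have := (hq.mul h21).const_mul_left 24
      exact (this.congr_left fun τ => by ring).congr_right fun τ => by ring
    exact ((t1.sub h4).sub t3).congr_left fun τ => by ring
  -- `E₄ − E₂² = O(q)` (first order)
  have hu1 : (fun τ : ℍ => E₄ τ - E2 τ ^ 2) =O[atImInfty] expDecay := by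
    have t : (fun τ : ℍ => (E2 τ - 1) * (E2 τ + 1)) =O[atImInfty] expDecay := by simpa using h21.mul (hE2b.add one1)
    exact (h41.sub t).congr_left fun τ => by ring
  have hu1' : (fun τ : ℍ => E2 τ ^ 2 - E₄ τ) =O[atImInfty] expDecay := hu1.neg_left.congr_left fun τ => by ring
  -- `qj − 1 = O(q)`, `qf₂ − 1 = O(q)`
  have e21 : (fun τ => expDecay τ ^ 2) =O[atImInfty] expDecay :=
    IsBigO.of_bound 1 (Eventually.of_forall fun τ => by
      rw [Real.norm_of_nonneg (sq_nonneg _), Real.norm_of_nonneg (expDecay_pos τ).le, one_mul, sq]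
      exact mul_le_of_le_one_left (expDecay_pos τ).le (expDecay_le_one τ))
  have hj1 : (fun τ : ℍ => qfun τ * kleinJ τ - 1) =O[atImInfty] expDecay := by
    have := (hj.trans e21).add (hq.const_mul_left 744); exact this.congr_left fun τ => by ring
  have GA : G24a =O[atImInfty] expDecay := (hu1.const_mul_left 6).congr_left fun τ => by simp [G24a]
  refine ⟨GA, ?_, ?_, ?_, ?_⟩
  · -- `q·G₂ = 1728q(E₂² − 1) + 6(qj − 1)(E₂² − E₄) + 6(E₂² − E₄ + 288q)`
    refine (isBigO_of_qfun_mul (m := 1) ?_).congr_right fun τ => pow_one _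
    have t1 : (fun τ : ℍ => 1728 * qfun τ * ((E2 τ - 1) * (E2 τ + 1))) =O[atImInfty] fun τ => expDecay τ ^ 2 := by
      have := (hq.mul (h21.mul (hE2b.add one1))).const_mul_left 1728
      refine (this.congr_left fun τ => by ring).congr_right fun τ => by simp [sq]
    have t2 : (fun τ : ℍ => 6 * ((qfun τ * kleinJ τ - 1) * (E2 τ ^ 2 - E₄ τ))) =O[atImInfty] fun τ => expDecay τ ^ 2 := by
      have := (hj1.mul hu1').const_mul_left 6; exact this.congr_right fun τ => by ring
    have := (t1.add t2).add (hu2.const_mul_left 6)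
    refine (this.congr_left fun τ => ?_).congr_right fun τ => by ring
    simp only [G24b]; ring
  · refine (isBigO_of_qfun_mul (m := 1) ?_).congr_right fun τ => pow_one _
    have t1 : (fun τ : ℍ => 5 * 1728 * qfun τ * (E₄ τ - 1)) =O[atImInfty] fun τ => expDecay τ ^ 2 := by
      have := (hq.mul h41).const_mul_left (5 * 1728)
      exact (this.congr_left fun τ => by ring).congr_right fun τ => by ring
    have t2 : (fun τ : ℍ => 7 * 1728 * qfun τ * ((E2 τ - 1) * (E2 τ + 1))) =O[atImInfty] fun τ => expDecay τ ^ 2 := by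
      have := (hq.mul (h21.mul (hE2b.add one1))).const_mul_left (7 * 1728)
      exact (this.congr_left fun τ => by ring).congr_right fun τ => by ring
    have t3 : (fun τ : ℍ => 12 * ((qfun τ * kleinJ τ - 1) * (E₄ τ - E2 τ ^ 2))) =O[atImInfty] fun τ => expDecay τ ^ 2 := by
      have := (hj1.mul hu1).const_mul_left 12; exact this.congr_right fun τ => by ring
    have := ((t1.sub t2).add t3).sub (hu2.const_mul_left 12)
    refine (this.congr_left fun τ => ?_).congr_right fun τ => by ring
    simp only [G24d]; ring
  · refine (isBigO_of_qfun_mul (m := 1) ?_).congr_right fun τ => pow_one _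
    -- `q·G₅/1728 = −5(qj−1−744q)E₄ − 2(qf₂−1)E₂ + 7(qj−1−744q)E₂² − 5(E₄−1−240q) − 2(E₂−1+24q)`
    --   `+ 7((E₂−1+24q)(E₂+1) − 24q(E₂−1)) + 744q(7(E₂²−1) − 5(E₄−1))`
    have hE22b : (fun τ : ℍ => E2 τ ^ 2) =O[atImInfty] fun _ : ℍ => (1 : ℝ) := by simpa [sq] using hE2b.mul hE2b
    have t1 : (fun τ : ℍ => (qfun τ * kleinJ τ - 1 - 744 * qfun τ) * E₄ τ) =O[atImInfty] fun τ => expDecay τ ^ 2 := by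
      simpa using hj.mul hE4b
    have t2 : (fun τ : ℍ => (qfun τ * f2fun τ - 1) * E2 τ) =O[atImInfty] fun τ => expDecay τ ^ 2 := by simpa using hf.mul hE2b
    have t3 : (fun τ : ℍ => (qfun τ * kleinJ τ - 1 - 744 * qfun τ) * E2 τ ^ 2) =O[atImInfty] fun τ => expDecay τ ^ 2 := by
      simpa using hj.mul hE22b
    have t6 : (fun τ : ℍ => (E2 τ - 1 + 24 * qfun τ) * (E2 τ + 1) - 24 * qfun τ * (E2 τ - 1)) =O[atImInfty]
        fun τ => expDecay τ ^ 2 := by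
      have a : (fun τ : ℍ => (E2 τ - 1 + 24 * qfun τ) * (E2 τ + 1)) =O[atImInfty] fun τ => expDecay τ ^ 2 := by
        simpa using h2.mul (hE2b.add one1)
      have b : (fun τ : ℍ => 24 * qfun τ * (E2 τ - 1)) =O[atImInfty] fun τ => expDecay τ ^ 2 := by
        have := (hq.mul h21).const_mul_left 24
        exact (this.congr_left fun τ => by ring).congr_right fun τ => by ring
      exact a.sub b
    have t7 : (fun τ : ℍ => 744 * qfun τ * (7 * ((E2 τ - 1) * (E2 τ + 1)) - 5 * (E₄ τ - 1))) =O[atImInfty]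
        fun τ => expDecay τ ^ 2 := by
      have a : (fun τ : ℍ => 7 * ((E2 τ - 1) * (E2 τ + 1)) - 5 * (E₄ τ - 1)) =O[atImInfty] expDecay := by
        have t : (fun τ : ℍ => (E2 τ - 1) * (E2 τ + 1)) =O[atImInfty] expDecay := by simpa using h21.mul (hE2b.add one1)
        exact (t.const_mul_left 7).sub (h41.const_mul_left 5)
      have := (hq.mul a).const_mul_left 744
      exact (this.congr_left fun τ => by ring).congr_right fun τ => by ring
    have := ((((((t1.const_mul_left (-5)).sub (t2.const_mul_left 2)).add (t3.const_mul_left 7)).sub (h4.const_mul_left 5)).sub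
      (h2.const_mul_left 2)).add (t6.const_mul_left 7)).add t7 |>.const_mul_left (1728 : ℂ)
    refine (this.congr_left fun τ => ?_).congr_right fun τ => by ring
    simp only [G24e]; ring
  · refine (isBigO_of_qfun_mul (m := 1) ?_).congr_right fun τ => pow_one _
    have t1 : (fun τ : ℍ => 1728 * qfun τ * (E₄ τ - 1)) =O[atImInfty] fun τ => expDecay τ ^ 2 := by
      have := (hq.mul h41).const_mul_left 1728
      exact (this.congr_left fun τ => by ring).congr_right fun τ => by ring
    have t2 : (fun τ : ℍ => 6 * ((qfun τ * kleinJ τ - 1) * (E₄ τ - E2 τ ^ 2))) =O[atImInfty] fun τ => expDecay τ ^ 2 := by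
      have := (hj1.mul hu1).const_mul_left 6; exact this.congr_right fun τ => by ring
    have := (t1.sub t2).add (hu2.const_mul_left 6)
    refine (this.congr_left fun τ => ?_).congr_right fun τ => by ring
    simp only [G24g]; ring

/-- On half-planes: `G₁, G₂, G₄, G₅, G₇ = O(e^{−2π Im z})` uniformly for `Im z ≥ δ`. [cite: CohnEtAl2019, Lemma 4.9 (proof)] -/
theorem G24_isBigO_halfPlane {δ : ℝ} (hδ : 0 < δ) :
    (G24a =O[𝓟 (halfPlane δ)] expDecay) ∧ (G24b =O[𝓟 (halfPlane δ)] expDecay) ∧ (G24d =O[𝓟 (halfPlane δ)] expDecay) ∧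
    (G24e =O[𝓟 (halfPlane δ)] expDecay) ∧ (G24g =O[𝓟 (halfPlane δ)] expDecay) := by
  obtain ⟨ha, hb, hd, he, hg⟩ := G24_isBigO_atImInfty
  have conv : ∀ {G : ℍ → ℂ}, Continuous G → (∀ τ : ℍ, G ((2 : ℝ) +ᵥ τ) = G τ) → G =O[atImInfty] expDecay →
      G =O[𝓟 (halfPlane δ)] expDecay := by
    intro G hc hp hO
    have := isBigO_halfPlane_of_two_periodic hc hp 1 (hO.congr_right fun τ => (pow_one _).symm) hδ
    exact this.congr_right fun τ => pow_one _
  have pj := kleinJ_vadd_two; have p2 := E2_vadd_two; have p4 := E₄_vadd_two; have pf := f2fun_vadd_two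
  refine ⟨conv (by unfold G24a; fun_prop) (fun τ => by simp [G24a, p2, p4]) ha,
    conv (by unfold G24b; fun_prop) (fun τ => by simp [G24b, p2, p4, pj]) hb,
    conv (by unfold G24d; fun_prop) (fun τ => by simp [G24d, p2, p4, pj]) hd,
    conv (by unfold G24e; fun_prop) (fun τ => by simp [G24e, p2, p4, pj, pf]) he,
    conv (by unfold G24g; fun_prop) (fun τ => by simp [G24g, p2, p4, pj]) hg⟩

/-! ## (4.15) for general rows -/

/-- If the rows are `O(|τ|²)` on `Im τ ≥ δ` then `L_R = O(|τ|²e^{−2π Im z})` on the product of half-planes.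
[cite: CohnEtAl2019, Lemma 4.9 (4.15)] -/
theorem plus24SBracket_isBigO {δ : ℝ} (hδ : 0 < δ) {Rm R0 R2 : ℍ → ℂ}
    (hm : Rm =O[𝓟 (halfPlane δ)] fun τ : ℍ => ‖(τ : ℂ)‖ ^ 2) (h0 : R0 =O[𝓟 (halfPlane δ)] fun τ : ℍ => ‖(τ : ℂ)‖ ^ 2)
    (h2 : R2 =O[𝓟 (halfPlane δ)] fun τ : ℍ => ‖(τ : ℂ)‖ ^ 2) :
    (fun p : ℍ × ℍ => plus24SBracket Rm R0 R2 p.1 p.2) =O[𝓟 (halfPlane δ ×ˢ halfPlane δ)]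
      fun p => ‖(p.1 : ℂ)‖ ^ 2 * expDecay p.2 := by
  obtain ⟨_, _, _, hΔ, hE4, hE6, _, _, _, hq1⟩ := halfPlane_isBigO_basic hδ
  obtain ⟨ga, gb, gd, ge, gg⟩ := G24_isBigO_halfPlane hδ
  set F := 𝓟 (halfPlane δ ×ˢ halfPlane δ)
  have bb : ∀ {u v : ℍ → ℂ}, u =O[𝓟 (halfPlane δ)] (fun _ : ℍ => (1 : ℝ)) → v =O[𝓟 (halfPlane δ)] (fun _ : ℍ => (1 : ℝ)) →
      (fun τ => u τ * v τ) =O[𝓟 (halfPlane δ)] fun _ : ℍ => (1 : ℝ) := fun hu hv => by simpa using hu.mul hv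
  have hΔ1 : (ModularForm.discriminant : ℍ → ℂ) =O[𝓟 (halfPlane δ)] fun _ : ℍ => (1 : ℝ) := hΔ.trans hq1
  have hE4_3 : (fun τ : ℍ => E₄ τ ^ 3) =O[𝓟 (halfPlane δ)] fun _ : ℍ => (1 : ℝ) := by
    have h2' : (fun τ : ℍ => E₄ τ ^ 2) =O[𝓟 (halfPlane δ)] fun _ : ℍ => (1 : ℝ) := by simpa [sq] using bb hE4 hE4
    simpa [pow_succ] using bb h2' hE4
  have hE4_6 : (fun τ : ℍ => E₄ τ ^ 6) =O[𝓟 (halfPlane δ)] fun _ : ℍ => (1 : ℝ) := by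
    simpa [← pow_add] using bb hE4_3 hE4_3
  have hE14 : E14fun =O[𝓟 (halfPlane δ)] fun _ : ℍ => (1 : ℝ) := (bb (bb hE4 hE4) hE6).congr_left fun τ => by simp [E14fun]
  have hE10 : E10fun =O[𝓟 (halfPlane δ)] fun _ : ℍ => (1 : ℝ) := (bb hE4 hE6).congr_left fun τ => by simp [E10fun]
  have hΔ2 : (fun τ : ℍ => ModularForm.discriminant τ ^ 2) =O[𝓟 (halfPlane δ)] fun _ : ℍ => (1 : ℝ) := by
    simpa [sq] using bb hΔ1 hΔ1
  have T : ∀ {a u v c : ℍ → ℂ}, a =O[𝓟 (halfPlane δ)] (fun τ : ℍ => ‖(τ : ℂ)‖ ^ 2) →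
      u =O[𝓟 (halfPlane δ)] (fun _ : ℍ => (1 : ℝ)) → v =O[𝓟 (halfPlane δ)] (fun _ : ℍ => (1 : ℝ)) →
      c =O[𝓟 (halfPlane δ)] expDecay →
      (fun p : ℍ × ℍ => a p.1 * u p.1 * v p.1 * c p.2) =O[F] fun p => ‖(p.1 : ℂ)‖ ^ 2 * expDecay p.2 := by
    intro a u v c ha hu hv hc
    have := (((isBigO_fst_of_halfPlane ha).mul (isBigO_fst_of_halfPlane hu)).mul (isBigO_fst_of_halfPlane hv)).mul
      (isBigO_snd_of_halfPlane hc)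
    simpa using this
  have one1 : (fun _ : ℍ => (1 : ℂ)) =O[𝓟 (halfPlane δ)] fun _ : ℍ => (1 : ℝ) :=
    isBigO_const_const (1 : ℂ) (one_ne_zero : (1 : ℝ) ≠ 0) _
  have s1 := T hm hE14 hE4_3 ga
  have s2 := T hm hE14 hΔ1 gb
  have s3 := T h0 hE4_6 one1 (ga.const_mul_left (-2))
  have s4 := T h0 hE4_3 hΔ1 gd
  have s5 := T h0 hΔ2 one1 ge
  have s6 := T h2 hE10 hE4_3 ga
  have s7 := T h2 hE10 hΔ1 gg
  have total := (((((s1.add s2).add s3).add s4).add s5).add s6).add s7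
  refine total.congr_left fun p => ?_
  simp only [plus24SBracket]; ring

/-- Conversion to the printed shape. [folklore] -/
theorem plus24Kernel_S_bound_of_isBigO {δ : ℝ} {Rm R0 R2 : ℍ → ℂ} {w : ℍ × ℍ → ℝ}
    (hw : ∀ p, 0 ≤ w p)
    (hO : (fun p : ℍ × ℍ => plus24SBracket Rm R0 R2 p.1 p.2) =O[𝓟 (halfPlane δ ×ˢ halfPlane δ)] w) :
    ∃ C : ℝ, ∀ τ z : ℍ, δ ≤ τ.im → δ ≤ z.im →
      ‖plus24Kernel Rm R0 R2 τ (ModularGroup.S • z) * (z : ℂ) ^ 10 *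
        (ModularForm.discriminant τ * ModularForm.discriminant z * (kleinJ τ - kleinJ z))‖ ≤ C * w (τ, z) := by
  obtain ⟨C, hC⟩ := isBigO_principal.1 hO
  refine ⟨‖(π : ℂ) ^ 2 / (36 * 1728 * I)‖ * |C|, fun τ z hτ hz => (norm_plus24Kernel_S_mul_le Rm R0 R2 τ z).trans ?_⟩
  have h := hC (τ, z) ⟨hτ, hz⟩
  rw [Real.norm_of_nonneg (hw _)] at h
  have h2 : ‖plus24SBracket Rm R0 R2 τ z‖ ≤ |C| * w (τ, z) := h.trans (mul_le_mul_of_nonneg_right (le_abs_self C) (hw _))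
  calc _ ≤ ‖(π : ℂ) ^ 2 / (36 * 1728 * I)‖ * (|C| * w (τ, z)) := mul_le_mul_of_nonneg_left h2 (norm_nonneg _)
    _ = _ := by ring

/-- **Lemma 4.9 (4.15) for `𝒦₊^{(24)}|₁₂γ`, `γ ∈ {I, T, TS}`** (multiplied-out form): on `Im τ, Im z ≥ δ`,
`‖(𝒦₊^{(24)}|₁₂γ)(τ,Sz)z^{10}·Δ(τ)Δ(z)(j(τ)−j(z))‖ ≤ C|τ|²|z|²e^{−2π Im z}`. [cite: CohnEtAl2019, Lemma 4.9 (4.15)] -/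
theorem kernelPlus24_S_bound_415 {δ : ℝ} (hδ : 0 < δ) (γ : SL(2, ℤ))
    (hγ : γ = 1 ∨ γ = ModularGroup.T ∨ γ = ModularGroup.T * ModularGroup.S) :
    ∃ C : ℝ, ∀ τ z : ℍ, δ ≤ τ.im → δ ≤ z.im →
      ‖((fun σ => kernelPlus24 σ (ModularGroup.S • z)) ∣[(12 : ℤ)] γ) τ * (z : ℂ) ^ 10 *
        (ModularForm.discriminant τ * ModularForm.discriminant z * (kleinJ τ - kleinJ z))‖
          ≤ C * (‖(τ : ℂ)‖ ^ 2 * ‖(z : ℂ)‖ ^ 2 * expDecay z) := by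
  obtain ⟨r1, r2, r3, r4, r5, r6⟩ := rows_isBigO_sq hδ
  obtain ⟨hφm, hφ0, hφ2⟩ := halfPlane_isBigO_phi hδ
  have up : ∀ {f : ℍ → ℂ}, f =O[𝓟 (halfPlane δ)] (fun τ : ℍ => ‖(τ : ℂ)‖) → f =O[𝓟 (halfPlane δ)] fun τ : ℍ => ‖(τ : ℂ)‖ ^ 2 := by
    intro f hf
    refine hf.trans ?_
    rw [isBigO_principal]
    refine ⟨1 / δ, fun τ hτ => ?_⟩
    have hτ1 : δ ≤ ‖(τ : ℂ)‖ := (mem_halfPlane.1 hτ).trans (im_le_norm_coe τ)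
    rw [norm_norm, Real.norm_of_nonneg (sq_nonneg _), sq, one_div, ← mul_assoc, inv_mul_eq_div]
    exact le_mul_of_one_le_left (norm_nonneg _) (by rw [le_div_iff₀ hδ, one_mul]; exact hτ1)
  have main : ∀ {Rm R0 R2 : ℍ → ℂ}, phiNeg2 ∣[(-2 : ℤ)] γ = Rm → phi0 ∣[(0 : ℤ)] γ = R0 → phi2 ∣[(2 : ℤ)] γ = R2 →
      Rm =O[𝓟 (halfPlane δ)] (fun τ : ℍ => ‖(τ : ℂ)‖ ^ 2) → R0 =O[𝓟 (halfPlane δ)] (fun τ : ℍ => ‖(τ : ℂ)‖ ^ 2) →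
      R2 =O[𝓟 (halfPlane δ)] (fun τ : ℍ => ‖(τ : ℂ)‖ ^ 2) →
      ∃ C : ℝ, ∀ τ z : ℍ, δ ≤ τ.im → δ ≤ z.im →
        ‖((fun σ => kernelPlus24 σ (ModularGroup.S • z)) ∣[(12 : ℤ)] γ) τ * (z : ℂ) ^ 10 *
          (ModularForm.discriminant τ * ModularForm.discriminant z * (kleinJ τ - kleinJ z))‖
            ≤ C * (‖(τ : ℂ)‖ ^ 2 * ‖(z : ℂ)‖ ^ 2 * expDecay z) := by
    intro Rm R0 R2 e1 e2 e3 hm h0 h2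
    have hw : ∀ p : ℍ × ℍ, 0 ≤ ‖(p.1 : ℂ)‖ ^ 2 * expDecay p.2 := fun p => mul_nonneg (sq_nonneg _) (expDecay_pos _).le
    obtain ⟨C, hC⟩ := plus24Kernel_S_bound_of_isBigO hw (plus24SBracket_isBigO hδ hm h0 h2)
    refine ⟨|C| / δ ^ 2, fun τ z hτ hz => ?_⟩
    have h := hC τ z hτ hz
    rw [kernelPlus24_eq_plus24Kernel, plus24Kernel_slash, e1, e2, e3]
    refine h.trans ?_
    have hz1 : δ ≤ ‖(z : ℂ)‖ := hz.trans (im_le_norm_coe z)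
    have hq := expDecay_pos z
    have h1 : C * (‖(τ : ℂ)‖ ^ 2 * expDecay z) ≤ |C| * (‖(τ : ℂ)‖ ^ 2 * expDecay z) :=
      mul_le_mul_of_nonneg_right (le_abs_self C) (mul_nonneg (sq_nonneg _) hq.le)
    refine h1.trans ?_
    rw [show |C| / δ ^ 2 * (‖(τ : ℂ)‖ ^ 2 * ‖(z : ℂ)‖ ^ 2 * expDecay z) =
      |C| * (‖(τ : ℂ)‖ ^ 2 * expDecay z) * (‖(z : ℂ)‖ / δ) ^ 2 by field_simp]
    refine le_mul_of_one_le_right (mul_nonneg (abs_nonneg C) (mul_nonneg (sq_nonneg _) hq.le)) ?_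
    have b : 1 ≤ ‖(z : ℂ)‖ / δ := by rw [le_div_iff₀ hδ]; linarith
    exact one_le_pow₀ b
  rcases hγ with rfl | rfl | rfl
  · exact main (by rw [SlashAction.slash_one]) (by rw [SlashAction.slash_one]) (by rw [SlashAction.slash_one])
      (up hφm) (up hφ0) (up hφ2)
  · obtain ⟨hT1, hT2, hT3⟩ := phi_rows_slash_T
    exact main hT1 hT2 hT3 r1 r2 r3
  · obtain ⟨hS1, hS2, hS3⟩ := phi_rows_slash_TS
    exact main hS1 hS2 hS3 r4 r5 r6

/-! ## (4.17): second-order `τ`-truncations for the rows `φ` -/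

/-- Uniform second-order heads on half-planes: `E₂ − 1 + 24q, E₄ − 1 − 240q, E₆ − 1 + 504q, Δ − q = O(q²)`,
`q = O(q)`, `q² = O(q)`. [cite: CohnEtAl2019, §2.1.1] -/
theorem halfPlane_heads {δ : ℝ} (hδ : 0 < δ) :
    ((fun τ : ℍ => E2 τ - 1 - (-24) * qfun τ) =O[𝓟 (halfPlane δ)] fun τ => expDecay τ ^ 2) ∧
    ((fun τ : ℍ => E₄ τ - 1 - 240 * qfun τ) =O[𝓟 (halfPlane δ)] fun τ => expDecay τ ^ 2) ∧
    ((fun τ : ℍ => E₆ τ - 1 - (-504) * qfun τ) =O[𝓟 (halfPlane δ)] fun τ => expDecay τ ^ 2) ∧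
    ((fun τ : ℍ => ModularForm.discriminant τ - qfun τ) =O[𝓟 (halfPlane δ)] fun τ => expDecay τ ^ 2) ∧
    ((fun τ : ℍ => qfun τ) =O[𝓟 (halfPlane δ)] expDecay) ∧
    ((fun τ : ℍ => expDecay τ ^ 2) =O[𝓟 (halfPlane δ)] expDecay) := by
  obtain ⟨⟨C4, h4⟩, ⟨C6, h6⟩, ⟨CD, hD⟩, ⟨C2, h2⟩⟩ := eisenstein_uniform hδ
  have hb0 : ∀ τ : ℍ, 0 ≤ expDecayHalf τ := fun τ => (expDecayHalf_pos τ).le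
  have mk : ∀ {f : ℍ → ℂ} (C : ℝ), (∀ τ : ℍ, δ ≤ τ.im → ‖f τ‖ ≤ C * expDecayHalf τ ^ 6) →
      f =O[𝓟 (halfPlane δ)] fun τ => expDecay τ ^ 2 := by
    intro f C h
    rw [isBigO_principal]
    refine ⟨|C|, fun τ hτ => (h τ hτ).trans ?_⟩
    rw [Real.norm_of_nonneg (sq_nonneg _), expDecay_pow_eq]
    have : expDecayHalf τ ^ 6 ≤ expDecayHalf τ ^ (2 * 2) := pow_le_pow_of_le_one (hb0 τ) (expDecayHalf_le_one τ) (by norm_num)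
    calc C * expDecayHalf τ ^ 6 ≤ |C| * expDecayHalf τ ^ 6 := mul_le_mul_of_nonneg_right (le_abs_self C) (pow_nonneg (hb0 τ) 6)
      _ ≤ |C| * expDecayHalf τ ^ (2 * 2) := mul_le_mul_of_nonneg_left this (abs_nonneg C)
  have hq : (fun τ : ℍ => qfun τ) =O[𝓟 (halfPlane δ)] expDecay := by
    rw [isBigO_principal]; exact ⟨1, fun τ _ => by rw [norm_qfun, Real.norm_of_nonneg (expDecay_pos τ).le, one_mul]⟩
  have hq2 : (fun τ : ℍ => qfun τ ^ 2) =O[𝓟 (halfPlane δ)] fun τ => expDecay τ ^ 2 := by simpa using hq.pow 2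
  have e21 : (fun τ : ℍ => expDecay τ ^ 2) =O[𝓟 (halfPlane δ)] expDecay := by
    rw [isBigO_principal]; exact ⟨1, fun τ _ => by
      rw [Real.norm_of_nonneg (sq_nonneg _), Real.norm_of_nonneg (expDecay_pos τ).le, one_mul, sq]
      exact mul_le_of_le_one_left (expDecay_pos τ).le (expDecay_le_one τ)⟩
  refine ⟨?_, ?_, ?_, ?_, hq, e21⟩
  · have := (mk C2 h2).sub (hq2.const_mul_left 72); exact this.congr_left fun τ => by ring
  · have := (mk C4 h4).add (hq2.const_mul_left 2160); exact this.congr_left fun τ => by ring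
  · have := (mk C6 h6).sub (hq2.const_mul_left 16632); exact this.congr_left fun τ => by ring
  · have := (mk CD hD).sub (hq2.const_mul_left 24); exact this.congr_left fun τ => by ring

/-- Multiplying heads: if `u = 1 + αq + O(q²)` and `v = 1 + βq + O(q²)` then `uv = 1 + (α+β)q + O(q²)`
(along any filter on which `q, q² = O(q)`), together with the derived facts `uv − 1 = O(q)`, `uv = O(1)`.
[folklore] -/
theorem head_mul {l : Filter ℍ} {u v : ℍ → ℂ} {α β : ℂ}
    (hq : (fun τ : ℍ => qfun τ) =O[l] expDecay) (he : (fun τ : ℍ => expDecay τ ^ 2) =O[l] expDecay)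
    (hu : (fun τ => u τ - 1 - α * qfun τ) =O[l] fun τ => expDecay τ ^ 2)
    (hv : (fun τ => v τ - 1 - β * qfun τ) =O[l] fun τ => expDecay τ ^ 2) :
    ((fun τ => u τ * v τ - 1 - (α + β) * qfun τ) =O[l] fun τ => expDecay τ ^ 2) := by
  have one1 : (fun _ : ℍ => (1 : ℂ)) =O[l] fun _ : ℍ => (1 : ℝ) := isBigO_const_const (1 : ℂ) (one_ne_zero : (1 : ℝ) ≠ 0) _
  have hv1 : (fun τ => v τ - 1) =O[l] expDecay := by
    have := (hv.trans he).add (hq.const_mul_left β); exact this.congr_left fun τ => by ring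
  have he1 : (expDecay : ℍ → ℝ) =O[l] fun _ : ℍ => (1 : ℝ) := IsBigO.of_bound 1 (Eventually.of_forall fun τ => by
    rw [Real.norm_of_nonneg (expDecay_pos τ).le, norm_one, mul_one]; exact expDecay_le_one τ)
  have hvb : v =O[l] fun _ : ℍ => (1 : ℝ) := by
    have := (hv1.trans he1).add one1; exact this.congr_left fun τ => by ring
  have t1 : (fun τ => (u τ - 1 - α * qfun τ) * v τ) =O[l] fun τ => expDecay τ ^ 2 := by simpa using hu.mul hvb
  have t3 : (fun τ => α * qfun τ * (v τ - 1)) =O[l] fun τ => expDecay τ ^ 2 := by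
    have := (hq.mul hv1).const_mul_left α
    exact (this.congr_left fun τ => by ring).congr_right fun τ => by ring
  exact ((t1.add hv).add t3).congr_left fun τ => by ring

/-- **The truncation identity for the rows `φ`**: `L_φ = Σᵢ (fᵢ − Pᵢ)Gᵢ`, i.e. `Σᵢ PᵢGᵢ = 0` for the
truncations `P₁ = τ(1 + 696q)`, `P₂ = τq`, `P₃ = (τ − 3i/π) + (1416τ − 4320i/π)q`, `P₄ = (τ − 3i/π)q`, `P₅ = 0`,
`P₆ = (τ − 6i/π) + (408τ − 2592i/π)q`, `P₇ = (τ − 6i/π)q` of the `τ`-functions modulo `q²`.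
[cite: CohnEtAl2019, Lemma 4.9 (proof)] -/
theorem plus24SBracket_phi_decomp (τ z : ℍ) : plus24SBracket phiNeg2 phi0 phi2 τ z =
    (τ : ℂ) * (E₄ τ ^ 5 * E₆ τ - 1 - 696 * qfun τ) * G24a z
    + (τ : ℂ) * (E₄ τ ^ 2 * E₆ τ * ModularForm.discriminant τ - qfun τ) * G24b z
    + ((τ : ℂ) * (E2 τ * E₄ τ ^ 6 - 1 - 1416 * qfun τ) - 3 * I / π * (E₄ τ ^ 6 - 1 - 1440 * qfun τ)) * (-2 * G24a z)
    + ((τ : ℂ) * (E2 τ * E₄ τ ^ 3 * ModularForm.discriminant τ - qfun τ)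
        - 3 * I / π * (E₄ τ ^ 3 * ModularForm.discriminant τ - qfun τ)) * G24d z
    + ((τ : ℂ) * E2 τ - 3 * I / π) * ModularForm.discriminant τ ^ 2 * G24e z
    + ((τ : ℂ) * (E2 τ ^ 2 * E₄ τ ^ 4 * E₆ τ - 1 - 408 * qfun τ) - 6 * I / π * (E2 τ * E₄ τ ^ 4 * E₆ τ - 1 - 432 * qfun τ)) * G24a z
    + ((τ : ℂ) * (E2 τ ^ 2 * E₄ τ * E₆ τ * ModularForm.discriminant τ - qfun τ)
        - 6 * I / π * (E2 τ * E₄ τ * E₆ τ * ModularForm.discriminant τ - qfun τ)) * G24g z := by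
  simp only [plus24SBracket, phiNeg2, phi0, phi2, G24a, G24b, G24d, G24e, G24g, E14fun, E10fun, Pi.mul_apply]
  ring

/-- The seven `τ`-remainders `fᵢ − Pᵢ` are `O(|τ|e^{−4π Im τ})` on half-planes. [cite: CohnEtAl2019, Lemma 4.9 (proof)] -/
theorem plus24_tau_remainders {δ : ℝ} (hδ : 0 < δ) :
    ((fun τ : ℍ => (τ : ℂ) * (E₄ τ ^ 5 * E₆ τ - 1 - 696 * qfun τ)) =O[𝓟 (halfPlane δ)] fun τ : ℍ => ‖(τ : ℂ)‖ * expDecay τ ^ 2) ∧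
    ((fun τ : ℍ => (τ : ℂ) * (E₄ τ ^ 2 * E₆ τ * ModularForm.discriminant τ - qfun τ)) =O[𝓟 (halfPlane δ)]
        fun τ : ℍ => ‖(τ : ℂ)‖ * expDecay τ ^ 2) ∧
    ((fun τ : ℍ => (τ : ℂ) * (E2 τ * E₄ τ ^ 6 - 1 - 1416 * qfun τ) - 3 * I / π * (E₄ τ ^ 6 - 1 - 1440 * qfun τ)) =O[𝓟 (halfPlane δ)]
        fun τ : ℍ => ‖(τ : ℂ)‖ * expDecay τ ^ 2) ∧
    ((fun τ : ℍ => (τ : ℂ) * (E2 τ * E₄ τ ^ 3 * ModularForm.discriminant τ - qfun τ)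
        - 3 * I / π * (E₄ τ ^ 3 * ModularForm.discriminant τ - qfun τ)) =O[𝓟 (halfPlane δ)] fun τ : ℍ => ‖(τ : ℂ)‖ * expDecay τ ^ 2) ∧
    ((fun τ : ℍ => ((τ : ℂ) * E2 τ - 3 * I / π) * ModularForm.discriminant τ ^ 2) =O[𝓟 (halfPlane δ)] fun τ : ℍ => ‖(τ : ℂ)‖ * expDecay τ ^ 2) ∧
    ((fun τ : ℍ => (τ : ℂ) * (E2 τ ^ 2 * E₄ τ ^ 4 * E₆ τ - 1 - 408 * qfun τ) - 6 * I / π * (E2 τ * E₄ τ ^ 4 * E₆ τ - 1 - 432 * qfun τ))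
        =O[𝓟 (halfPlane δ)] fun τ : ℍ => ‖(τ : ℂ)‖ * expDecay τ ^ 2) ∧
    ((fun τ : ℍ => (τ : ℂ) * (E2 τ ^ 2 * E₄ τ * E₆ τ * ModularForm.discriminant τ - qfun τ)
        - 6 * I / π * (E2 τ * E₄ τ * E₆ τ * ModularForm.discriminant τ - qfun τ)) =O[𝓟 (halfPlane δ)] fun τ : ℍ => ‖(τ : ℂ)‖ * expDecay τ ^ 2) := by
  obtain ⟨h2, h4, h6, hD, hq, he⟩ := halfPlane_heads hδ
  obtain ⟨_, _, _, hΔ, hE4, hE6, hE2, h1, hcoe, hq1⟩ := halfPlane_isBigO_basic hδ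
  set l := 𝓟 (halfPlane δ)
  have HM := fun {u v : ℍ → ℂ} {α β : ℂ} (hu : (fun τ => u τ - 1 - α * qfun τ) =O[l] fun τ => expDecay τ ^ 2)
    (hv : (fun τ => v τ - 1 - β * qfun τ) =O[l] fun τ => expDecay τ ^ 2) => head_mul hq he hu hv
  -- powers of `E₄`
  have p2 : (fun τ : ℍ => E₄ τ ^ 2 - 1 - 480 * qfun τ) =O[l] fun τ => expDecay τ ^ 2 := by
    have := HM h4 h4; exact this.congr_left fun τ => by ring
  have p3 : (fun τ : ℍ => E₄ τ ^ 3 - 1 - 720 * qfun τ) =O[l] fun τ => expDecay τ ^ 2 := by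
    have := HM p2 h4; exact this.congr_left fun τ => by ring
  have p4 : (fun τ : ℍ => E₄ τ ^ 4 - 1 - 960 * qfun τ) =O[l] fun τ => expDecay τ ^ 2 := by
    have := HM p3 h4; exact this.congr_left fun τ => by ring
  have p5 : (fun τ : ℍ => E₄ τ ^ 5 - 1 - 1200 * qfun τ) =O[l] fun τ => expDecay τ ^ 2 := by
    have := HM p4 h4; exact this.congr_left fun τ => by ring
  have p6 : (fun τ : ℍ => E₄ τ ^ 6 - 1 - 1440 * qfun τ) =O[l] fun τ => expDecay τ ^ 2 := by
    have := HM p5 h4; exact this.congr_left fun τ => by ring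
  -- the monomials
  have m1 : (fun τ : ℍ => E₄ τ ^ 5 * E₆ τ - 1 - 696 * qfun τ) =O[l] fun τ => expDecay τ ^ 2 := by
    have := HM p5 h6; exact this.congr_left fun τ => by ring
  have m46 : (fun τ : ℍ => E₄ τ ^ 4 * E₆ τ - 1 - 456 * qfun τ) =O[l] fun τ => expDecay τ ^ 2 := by
    have := HM p4 h6; exact this.congr_left fun τ => by ring
  have m246 : (fun τ : ℍ => E2 τ * E₄ τ ^ 4 * E₆ τ - 1 - 432 * qfun τ) =O[l] fun τ => expDecay τ ^ 2 := by
    have := HM h2 m46; exact this.congr_left fun τ => by ring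
  have m2246 : (fun τ : ℍ => E2 τ ^ 2 * E₄ τ ^ 4 * E₆ τ - 1 - 408 * qfun τ) =O[l] fun τ => expDecay τ ^ 2 := by
    have := HM h2 m246; exact this.congr_left fun τ => by ring
  have m26 : (fun τ : ℍ => E2 τ * E₄ τ ^ 6 - 1 - 1416 * qfun τ) =O[l] fun τ => expDecay τ ^ 2 := by
    have := HM h2 p6; exact this.congr_left fun τ => by ring
  -- `uΔ − q = (u − 1)Δ + (Δ − q)` with `u − 1 = O(q)`, `Δ = O(q)`
  have first : ∀ {u : ℍ → ℂ} {γ : ℂ}, (fun τ => u τ - 1 - γ * qfun τ) =O[l] (fun τ => expDecay τ ^ 2) →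
      (fun τ => u τ - 1) =O[l] expDecay := by
    intro u γ hu
    have := (hu.trans he).add (hq.const_mul_left γ); exact this.congr_left fun τ => by ring
  have DM : ∀ {u : ℍ → ℂ} {γ : ℂ}, (fun τ => u τ - 1 - γ * qfun τ) =O[l] (fun τ => expDecay τ ^ 2) →
      (fun τ => u τ * ModularForm.discriminant τ - qfun τ) =O[l] fun τ => expDecay τ ^ 2 := by
    intro u γ hu
    have t1 : (fun τ => (u τ - 1) * ModularForm.discriminant τ) =O[l] fun τ => expDecay τ ^ 2 := by
      simpa [sq] using (first hu).mul hΔ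
    exact (t1.add hD).congr_left fun τ => by ring
  have m426 : (fun τ : ℍ => E₄ τ ^ 2 * E₆ τ - 1 - (-24) * qfun τ) =O[l] fun τ => expDecay τ ^ 2 := by
    have := HM p2 h6; exact this.congr_left fun τ => by ring
  have m23 : (fun τ : ℍ => E2 τ * E₄ τ ^ 3 - 1 - 696 * qfun τ) =O[l] fun τ => expDecay τ ^ 2 := by
    have := HM h2 p3; exact this.congr_left fun τ => by ring
  have m46' : (fun τ : ℍ => E₄ τ * E₆ τ - 1 - (-264) * qfun τ) =O[l] fun τ => expDecay τ ^ 2 := by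
    have := HM h4 h6; exact this.congr_left fun τ => by ring
  have m2246' : (fun τ : ℍ => E2 τ ^ 2 * E₄ τ * E₆ τ - 1 - (-312) * qfun τ) =O[l] fun τ => expDecay τ ^ 2 := by
    have := HM h2 (HM h2 m46'); exact this.congr_left fun τ => by ring
  have m246' : (fun τ : ℍ => E2 τ * E₄ τ * E₆ τ - 1 - (-288) * qfun τ) =O[l] fun τ => expDecay τ ^ 2 := by
    have := HM h2 m46'; exact this.congr_left fun τ => by ring
  have d1 := DM m426
  have d2 := DM m23
  have d3 := DM p3
  have d4 := DM m2246'
  have d5 := DM m246'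
  -- `τ·O(q²) + const·O(q²) = O(|τ|q²)`
  have upc : ∀ {f : ℍ → ℂ} (c : ℂ), f =O[l] (fun τ => expDecay τ ^ 2) →
      (fun τ => c * f τ) =O[l] fun τ : ℍ => ‖(τ : ℂ)‖ * expDecay τ ^ 2 := by
    intro f c hf
    have := (h1.mul hf).const_mul_left c
    simpa using this
  have upt : ∀ {f : ℍ → ℂ}, f =O[l] (fun τ => expDecay τ ^ 2) →
      (fun τ => (τ : ℂ) * f τ) =O[l] fun τ : ℍ => ‖(τ : ℂ)‖ * expDecay τ ^ 2 := fun hf => hcoe.mul hf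
  refine ⟨upt m1, upt (d1.congr_left fun τ => by ring), (upt m26).sub (upc _ p6),
    (upt (d2.congr_left fun τ => by ring)).sub (upc _ (d3.congr_left fun τ => by ring)), ?_,
    (upt m2246).sub (upc _ m246), (upt (d4.congr_left fun τ => by ring)).sub (upc _ (d5.congr_left fun τ => by ring))⟩
  -- `φ₀ Δ² = O(|τ| q²)`
  obtain ⟨_, hφ0, _⟩ := halfPlane_isBigO_phi hδ
  have hΔ2 : (fun τ : ℍ => ModularForm.discriminant τ ^ 2) =O[l] fun τ => expDecay τ ^ 2 := by simpa using hΔ.pow 2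
  have := hφ0.mul hΔ2
  exact this.congr_left fun τ => by simp [phi0]

/-- **`L_φ = O(|τ|e^{−4π Im τ}e^{−2π Im z})`** on the product of half-planes. [cite: CohnEtAl2019, Lemma 4.9 (4.17)] -/
theorem plus24SBracket_phi_isBigO {δ : ℝ} (hδ : 0 < δ) :
    (fun p : ℍ × ℍ => plus24SBracket phiNeg2 phi0 phi2 p.1 p.2) =O[𝓟 (halfPlane δ ×ˢ halfPlane δ)]
      fun p => ‖(p.1 : ℂ)‖ * expDecay p.1 ^ 2 * expDecay p.2 := by
  obtain ⟨r1, r2, r3, r4, r5, r6, r7⟩ := plus24_tau_remainders hδ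
  obtain ⟨ga, gb, gd, ge, gg⟩ := G24_isBigO_halfPlane hδ
  set F := 𝓟 (halfPlane δ ×ˢ halfPlane δ)
  have T : ∀ {a c : ℍ → ℂ}, a =O[𝓟 (halfPlane δ)] (fun τ : ℍ => ‖(τ : ℂ)‖ * expDecay τ ^ 2) →
      c =O[𝓟 (halfPlane δ)] expDecay →
      (fun p : ℍ × ℍ => a p.1 * c p.2) =O[F] fun p => ‖(p.1 : ℂ)‖ * expDecay p.1 ^ 2 * expDecay p.2 :=
    fun ha hc => (isBigO_fst_of_halfPlane ha).mul (isBigO_snd_of_halfPlane hc)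
  have s1 := T r1 ga
  have s2 := T r2 gb
  have s3 := T r3 (ga.const_mul_left (-2))
  have s4 := T r4 gd
  have s5 := T r5 ge
  have s6 := T r6 ga
  have s7 := T r7 gg
  have total := (((((s1.add s2).add s3).add s4).add s5).add s6).add s7
  refine total.congr_left fun p => ?_
  rw [plus24SBracket_phi_decomp]

/-- **Lemma 4.9 (4.17) for `𝒦₊^{(24)}`** (multiplied-out form): on `Im τ, Im z ≥ δ`,
`‖𝒦₊^{(24)}(τ,Sz)z^{10}·Δ(τ)Δ(z)(j(τ)−j(z))‖ ≤ C|τ|²|z|²e^{−4π Im τ}e^{−π Im z}`. [cite: CohnEtAl2019, Lemma 4.9 (4.17)] -/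
theorem kernelPlus24_S_bound_417 {δ : ℝ} (hδ : 0 < δ) : ∃ C : ℝ, ∀ τ z : ℍ, δ ≤ τ.im → δ ≤ z.im →
    ‖kernelPlus24 τ (ModularGroup.S • z) * (z : ℂ) ^ 10 *
      (ModularForm.discriminant τ * ModularForm.discriminant z * (kleinJ τ - kleinJ z))‖
        ≤ C * (‖(τ : ℂ)‖ ^ 2 * ‖(z : ℂ)‖ ^ 2 * expDecay τ ^ 2 * expDecayHalf z) := by
  have hw : ∀ p : ℍ × ℍ, 0 ≤ ‖(p.1 : ℂ)‖ * expDecay p.1 ^ 2 * expDecay p.2 := fun p =>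
    mul_nonneg (mul_nonneg (norm_nonneg _) (sq_nonneg _)) (expDecay_pos _).le
  obtain ⟨C, hC⟩ := plus24Kernel_S_bound_of_isBigO hw (plus24SBracket_phi_isBigO hδ)
  refine ⟨|C| / δ ^ 3, fun τ z hτ hz => ?_⟩
  have h := hC τ z hτ hz
  rw [kernelPlus24_eq_plus24Kernel]
  refine h.trans ?_
  have hτ1 : δ ≤ ‖(τ : ℂ)‖ := hτ.trans (im_le_norm_coe τ)
  have hz1 : δ ≤ ‖(z : ℂ)‖ := hz.trans (im_le_norm_coe z)
  have hq := expDecay_pos z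
  have hqh := expDecayHalf_pos z
  have hqτ := expDecay_pos τ
  have hqb : expDecay z ≤ expDecayHalf z := by
    rw [expDecay_eq_sq, sq]; exact mul_le_of_le_one_left hqh.le (expDecayHalf_le_one z)
  have hX0 : 0 ≤ ‖(τ : ℂ)‖ * expDecay τ ^ 2 * expDecay z := hw (τ, z)
  have h1 : C * (‖(τ : ℂ)‖ * expDecay τ ^ 2 * expDecay z) ≤ |C| * (‖(τ : ℂ)‖ * expDecay τ ^ 2 * expDecayHalf z) := by
    have : C * (‖(τ : ℂ)‖ * expDecay τ ^ 2 * expDecay z) ≤ |C| * (‖(τ : ℂ)‖ * expDecay τ ^ 2 * expDecay z) :=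
      mul_le_mul_of_nonneg_right (le_abs_self C) hX0
    exact this.trans (mul_le_mul_of_nonneg_left (mul_le_mul_of_nonneg_left hqb
      (mul_nonneg (norm_nonneg _) (sq_nonneg _))) (abs_nonneg C))
  refine h1.trans ?_
  rw [show |C| / δ ^ 3 * (‖(τ : ℂ)‖ ^ 2 * ‖(z : ℂ)‖ ^ 2 * expDecay τ ^ 2 * expDecayHalf z) =
    |C| * (‖(τ : ℂ)‖ * expDecay τ ^ 2 * expDecayHalf z) * ((‖(τ : ℂ)‖ / δ) * (‖(z : ℂ)‖ / δ) ^ 2) by field_simp]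
  refine le_mul_of_one_le_right (mul_nonneg (abs_nonneg C) (mul_nonneg (mul_nonneg (norm_nonneg _) (sq_nonneg _)) hqh.le)) ?_
  have a : 1 ≤ ‖(τ : ℂ)‖ / δ := by rw [le_div_iff₀ hδ]; linarith
  have b : 1 ≤ ‖(z : ℂ)‖ / δ := by rw [le_div_iff₀ hδ]; linarith
  nlinarith [one_le_pow₀ (n := 2) b]

end Literature.NumberTheory.ModularForms
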